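import Summits.Langlands.Langlands.Theorems.IrreducibilityBySelfDualityIrreducibleOffSectorCliffordGalois
import Summits.Langlands.Langlands.Theorems.IrreducibilityBySelfDualityIrreducibleOffSectorBaseChange
import HarnessLib

/-!
# Base-change ASCENT of the conclusion of `IrreducibleOffSector` along cyclic extensions
(crux stmt-Langlands-14329 `IrreducibilityBySelfDuality.IrreducibleOffSector`, line `Sketch`;
`--supports` file, STRUCTURAL: no import of the route module; continuation lead c7)

The crux says: for a cuspidal L-algebraic `π` on `GL_n(𝔸_K)` off the sector, every
`ρ : Γ_K → GL_n(ℚ̄_ℓ)` Satake–Frobenius compatible with `(π, ι)` almost everywhere is irreducible.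
Lead c4 proved that this conclusion DESCENDS along weak base change
(`isIrreducible_of_isWeakBaseChangeLiftAE`, `…IrreducibleOffSectorBaseChange`, p121124).  This
file proves the converse direction, the SEVENTH closure operator of the line: the conclusion
ASCENDS along weak base change to a finite Galois extension `L/K` with CYCLIC Galois group
(Arthur–Clozel, Ch. 3, Thm. 4.2: cyclic prime degree; iterate for solvable towers), given ONE
irreducible avatar `ρ₀` of `π` that is not self-twisted by the characters of `Gal(L/K)`:

* `isIrreducible_of_isWeakBaseChangeLiftAE_ascent` — `Π` on `GL_n(𝔸_L)` a weak base-change lift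
  of `π` (`IsWeakBaseChangeLiftAE π Π`: `t_{Π,w} = t_{π,v}^{f(w|v)}` a.e.), `ρ₀ : Γ_K → GL_n(ℚ̄_ℓ)`
  irreducible and a.e.-compatible with `(π, ι)`, and `ρ₀ ≇ ρ₀ ⊗ χ` for every non-trivial
  character `χ` of `Γ_K` trivial on `res(Γ_L)` ⟹ every `ρ' : Γ_L → GL_n(ℚ̄_ℓ)` a.e.-compatible
  with `(Π, ι)` is irreducible.  Proof: `ρ₀|_{Γ_L}` is a.e.-compatible with `Π`
  (`eventually_satakeFrobCompatibleAt_restrictField`, Arthur–Clozel Ch. 3 (1.1)) and irreducible by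
  Clifford's dichotomy (`isIrreducible_restrictField_or_exists_selfTwist`,
  `…IrreducibleOffSectorCliffordGalois`); irreducibility passes from `ρ₀|_{Γ_L}` to every other
  a.e.-compatible `ρ'` by the Chebotarev–Brauer–Nesbitt transfer
  (`isIrreducible_of_satakeFrobCompatible`, p79199).
* `isIrreducible_of_isWeakBaseChangeLiftAE_of_coprime` — when `gcd(n, [L:K]) = 1` the self-twist
  hypothesis is void (`isIrreducible_restrictField_of_coprime`): irreducibility of one avatar of
  `π` gives the crux's conclusion for every weak base change of `π` to `L` (e.g. `GL_2` and cubic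
  cyclic `L/K`; odd `n` and quadratic `L/K`).
* `irreducibleOffSector_conclusion_ascent`, `…_ascent_of_coprime` — the same in the crux's binder
  shape: the crux's conclusion for `π` over `K` at `(ℓ, ι)` (all a.e.-compatible `ρ` irreducible)
  plus ONE a.e.-compatible avatar `ρ₀` (not self-twisted by `Gal(L/K)`, resp. `gcd(n,[L:K]) = 1`)
  gives the crux's conclusion at `(ℓ, ι)` for every weak base-change lift `Π` of `π` to `L` —
  cuspidal or not, algebraic or not, in or off the sector.

With c4's descent this makes the crux's conclusion INVARIANT under cyclic base change of degree
prime to `n` (given an avatar downstairs), and reduces the general cyclic case to the absence of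
Galois self-twists — the Galois mirror of Arthur–Clozel's cuspidality criterion
`BC_{L/K}(π)` cuspidal ⟺ `π ≇ π ⊗ η` for all `η ≠ 1` trivial on `N_{L/K}𝔸_L^×` (Ch. 3,
Thm. 4.2 (a), Lemma 6.3).

References: J. Arthur, L. Clozel, *Simple algebras, base change, and the advanced theory of the
trace formula*, Ann. of Math. Stud. 120 (1989), Ch. 3 §1 (1.1), Thm. 4.2, Lemma 6.3;
A. H. Clifford, Ann. of Math. 38 (1937), Thm. 1; P. Deligne, J.-P. Serre, ASENS 7 (1974),
Lemme 3.2 (Chebotarev–Brauer–Nesbitt).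
-/

noncomputable section

-- `Summit.Langlands.Langlands.…` (summit = sub-problem name, D-0017 layout) trips `dupNamespace`.
set_option linter.dupNamespace false

open scoped NumberField Classical
open Filter IsDedekindDomain
open Literature.RepresentationTheory.Semisimple
open Literature.NumberTheory.Automorphic Literature.NumberTheory.GaloisRepresentations Field
open Summit.Langlands

namespace Summit.Langlands.Langlands.Theorems.IrreducibleOffSector

/-- **Base-change ascent of irreducibility (cyclic `L/K`, no Galois self-twist).**  Let `L/K` be a
finite Galois extension of number fields with cyclic Galois group, `Π` on `GL_n(𝔸_L)` a weak
base-change lift of `π` on `GL_n(𝔸_K)` (`IsWeakBaseChangeLiftAE`), and `ρ₀ : Γ_K → GL_n(ℚ̄_ℓ)` an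
IRREDUCIBLE representation, Satake–Frobenius compatible with `(π, ι)` at almost all places, which
is not self-twisted by any non-trivial character of `Γ_K` trivial on `res(Γ_L)` (`hnst`).  Then
every `ρ' : Γ_L → GL_n(ℚ̄_ℓ)` Satake–Frobenius compatible with `(Π, ι)` at almost all places is
irreducible: `ρ₀|_{Γ_L}` is compatible with `Π` and irreducible (Clifford's dichotomy), and
irreducibility transfers (Chebotarev–Brauer–Nesbitt).
[cite: ArthurClozelAMS120, Ch. 3 §1 (1.1), Thm. 4.2 and Lemma 6.3] -/
theorem isIrreducible_of_isWeakBaseChangeLiftAE_ascent {K : Type} [Field K] [NumberField K] {L : Type} [Field L]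
    [NumberField L] [Algebra K L] [IsGalois K L] {ℓ : ℕ} [Fact ℓ.Prime] {n : ℕ}
    {hK : isCompact_glFiniteIntegralLevel n K} {hL : isCompact_glFiniteIntegralLevel n L}
    (hcyc : IsCyclic (L ≃ₐ[K] L))
    (ι : PadicAlgCl ℓ ≃+* ℂ) (π : AutomorphicRepData (AutomorphyDatum.gl n K hK))
    (P : AutomorphicRepData (AutomorphyDatum.gl n L hL)) (hBC : IsWeakBaseChangeLiftAE π P)
    (ρ₀ : FramedGaloisRep K (PadicAlgCl ℓ) n) (hirr₀ : ρ₀.toGaloisRep.IsIrreducible)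
    (h₀ : ∀ᶠ v : HeightOneSpectrum (𝓞 K) in cofinite, SatakeFrobCompatibleAt ι π ρ₀ v)
    (hnst : ∀ χ : absoluteGaloisGroup K →* (PadicAlgCl ℓ)ˣ,
      (∀ σ ∈ ((absGaloisRestrict K L).range : Subgroup (absoluteGaloisGroup K)), χ σ = 1) →
        χ ≠ 1 → IsEmpty ((FramedRep.toRepresentation ρ₀).Equiv
          (Representation.twist (FramedRep.toRepresentation ρ₀) χ)))
    (ρ' : FramedGaloisRep L (PadicAlgCl ℓ) n)
    (hρ' : ∀ᶠ w : HeightOneSpectrum (𝓞 L) in cofinite, SatakeFrobCompatibleAt ι P ρ' w) :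
    ρ'.toGaloisRep.IsIrreducible := by
  have hres : (ρ₀.restrictField L).toGaloisRep.IsIrreducible := by
    rcases isIrreducible_restrictField_or_exists_selfTwist hcyc ρ₀ hirr₀ with h | ⟨χ, hχL, hχ1, -, ⟨e⟩⟩
    · exact h
    · exact ((hnst χ hχL hχ1).false e).elim
  exact isIrreducible_of_satakeFrobCompatible P ι hres
    (eventually_satakeFrobCompatibleAt_restrictField ι π P hBC ρ₀ h₀) hρ'

/-- **Base-change ascent of irreducibility, degree prime to the rank.**  Let `L/K` be a finite
Galois extension of number fields with cyclic Galois group and `gcd(n, [L:K]) = 1`, `Π` a weak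
base-change lift of `π` to `GL_n(𝔸_L)`, and `ρ₀ : Γ_K → GL_n(ℚ̄_ℓ)` irreducible and
Satake–Frobenius compatible with `(π, ι)` at almost all places.  Then every
`ρ' : Γ_L → GL_n(ℚ̄_ℓ)` Satake–Frobenius compatible with `(Π, ι)` at almost all places is
irreducible — no self-twist hypothesis (`isIrreducible_restrictField_of_coprime`).
[cite: ArthurClozelAMS120, Ch. 3 §1 (1.1) and Thm. 4.2] -/
theorem isIrreducible_of_isWeakBaseChangeLiftAE_of_coprime {K : Type} [Field K] [NumberField K] {L : Type} [Field L]
    [NumberField L] [Algebra K L] [IsGalois K L] {ℓ : ℕ} [Fact ℓ.Prime] {n : ℕ}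
    {hK : isCompact_glFiniteIntegralLevel n K} {hL : isCompact_glFiniteIntegralLevel n L}
    (hcyc : IsCyclic (L ≃ₐ[K] L))
    (hcop : Nat.Coprime n (Module.finrank K L))
    (ι : PadicAlgCl ℓ ≃+* ℂ) (π : AutomorphicRepData (AutomorphyDatum.gl n K hK))
    (P : AutomorphicRepData (AutomorphyDatum.gl n L hL)) (hBC : IsWeakBaseChangeLiftAE π P)
    (ρ₀ : FramedGaloisRep K (PadicAlgCl ℓ) n) (hirr₀ : ρ₀.toGaloisRep.IsIrreducible)
    (h₀ : ∀ᶠ v : HeightOneSpectrum (𝓞 K) in cofinite, SatakeFrobCompatibleAt ι π ρ₀ v)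
    (ρ' : FramedGaloisRep L (PadicAlgCl ℓ) n)
    (hρ' : ∀ᶠ w : HeightOneSpectrum (𝓞 L) in cofinite, SatakeFrobCompatibleAt ι P ρ' w) :
    ρ'.toGaloisRep.IsIrreducible :=
  isIrreducible_of_satakeFrobCompatible P ι
    (isIrreducible_restrictField_of_coprime hcyc hcop ρ₀ hirr₀)
    (eventually_satakeFrobCompatibleAt_restrictField ι π P hBC ρ₀ h₀) hρ'

/-- **The crux ascends along cyclic base change (binder shape, no Galois self-twist).**  GIVEN the
conclusion of `IrreducibleOffSector` for `π` on `GL_n(𝔸_K)` at `(ℓ, ι)` — every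
`ρ : Γ_K → GL_n(ℚ̄_ℓ)` a.e.-compatible with `(π, ι)` is irreducible (`hIK`) — and ONE
a.e.-compatible `ρ₀` admitting no self-twist by the non-trivial characters of `Γ_K` trivial on
`res(Γ_L)`, the conclusion holds at `(ℓ, ι)` for every weak base-change lift `Π` of `π` to the
cyclic extension `L`: every `ρ' : Γ_L → GL_n(ℚ̄_ℓ)` a.e.-compatible with `(Π, ι)` is irreducible
(whatever `Π` is: cuspidal or not, algebraic or not, in or off the sector).
[cite: ArthurClozelAMS120, Ch. 3 §1 (1.1), Thm. 4.2 and Lemma 6.3] -/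
theorem irreducibleOffSector_conclusion_ascent {K : Type} [Field K] [NumberField K] {L : Type} [Field L]
    [NumberField L] [Algebra K L] [IsGalois K L] {ℓ : ℕ} [Fact ℓ.Prime] {n : ℕ}
    {hK : isCompact_glFiniteIntegralLevel n K} {hL : isCompact_glFiniteIntegralLevel n L}
    (hcyc : IsCyclic (L ≃ₐ[K] L))
    (ι : PadicAlgCl ℓ ≃+* ℂ) (π : AutomorphicRepData (AutomorphyDatum.gl n K hK))
    (hIK : ∀ ρ : FramedGaloisRep K (PadicAlgCl ℓ) n,
      (∀ᶠ v : HeightOneSpectrum (𝓞 K) in cofinite, SatakeFrobCompatibleAt ι π ρ v) →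
        ρ.toGaloisRep.IsIrreducible)
    (ρ₀ : FramedGaloisRep K (PadicAlgCl ℓ) n)
    (h₀ : ∀ᶠ v : HeightOneSpectrum (𝓞 K) in cofinite, SatakeFrobCompatibleAt ι π ρ₀ v)
    (hnst : ∀ χ : absoluteGaloisGroup K →* (PadicAlgCl ℓ)ˣ,
      (∀ σ ∈ ((absGaloisRestrict K L).range : Subgroup (absoluteGaloisGroup K)), χ σ = 1) →
        χ ≠ 1 → IsEmpty ((FramedRep.toRepresentation ρ₀).Equiv
          (Representation.twist (FramedRep.toRepresentation ρ₀) χ)))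
    (P : AutomorphicRepData (AutomorphyDatum.gl n L hL)) (hBC : IsWeakBaseChangeLiftAE π P)
    (ρ' : FramedGaloisRep L (PadicAlgCl ℓ) n)
    (hρ' : ∀ᶠ w : HeightOneSpectrum (𝓞 L) in cofinite, SatakeFrobCompatibleAt ι P ρ' w) :
    ρ'.toGaloisRep.IsIrreducible :=
  isIrreducible_of_isWeakBaseChangeLiftAE_ascent hcyc ι π P hBC ρ₀ (hIK ρ₀ h₀) h₀ hnst ρ' hρ'

/-- **The crux ascends along cyclic base change of degree prime to the rank (binder shape).**
GIVEN the conclusion of `IrreducibleOffSector` for `π` on `GL_n(𝔸_K)` at `(ℓ, ι)` (`hIK`) and ONE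
a.e.-compatible `ρ₀`, the conclusion holds at `(ℓ, ι)` for every weak base-change lift `Π` of `π`
to a cyclic extension `L/K` with `gcd(n, [L:K]) = 1`.  Together with the descent
`isIrreducible_of_isWeakBaseChangeLiftAE` (p121124) the crux's conclusion is INVARIANT under such
base changes, given an avatar downstairs. [cite: ArthurClozelAMS120, Ch. 3 §1 (1.1) and Thm. 4.2] -/
theorem irreducibleOffSector_conclusion_ascent_of_coprime {K : Type} [Field K] [NumberField K] {L : Type} [Field L]
    [NumberField L] [Algebra K L] [IsGalois K L] {ℓ : ℕ} [Fact ℓ.Prime] {n : ℕ}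
    {hK : isCompact_glFiniteIntegralLevel n K} {hL : isCompact_glFiniteIntegralLevel n L}
    (hcyc : IsCyclic (L ≃ₐ[K] L))
    (hcop : Nat.Coprime n (Module.finrank K L))
    (ι : PadicAlgCl ℓ ≃+* ℂ) (π : AutomorphicRepData (AutomorphyDatum.gl n K hK))
    (hIK : ∀ ρ : FramedGaloisRep K (PadicAlgCl ℓ) n,
      (∀ᶠ v : HeightOneSpectrum (𝓞 K) in cofinite, SatakeFrobCompatibleAt ι π ρ v) →
        ρ.toGaloisRep.IsIrreducible)
    (ρ₀ : FramedGaloisRep K (PadicAlgCl ℓ) n)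
    (h₀ : ∀ᶠ v : HeightOneSpectrum (𝓞 K) in cofinite, SatakeFrobCompatibleAt ι π ρ₀ v)
    (P : AutomorphicRepData (AutomorphyDatum.gl n L hL)) (hBC : IsWeakBaseChangeLiftAE π P)
    (ρ' : FramedGaloisRep L (PadicAlgCl ℓ) n)
    (hρ' : ∀ᶠ w : HeightOneSpectrum (𝓞 L) in cofinite, SatakeFrobCompatibleAt ι P ρ' w) :
    ρ'.toGaloisRep.IsIrreducible :=
  isIrreducible_of_isWeakBaseChangeLiftAE_of_coprime hcyc hcop ι π P hBC ρ₀ (hIK ρ₀ h₀) h₀ ρ' hρ'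

end Summit.Langlands.Langlands.Theorems.IrreducibleOffSector

end
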